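import Summits.Ventures.CertifiedManyBodySolver.Upper.StripCellSpinCharge
import Summits.Ventures.CertifiedManyBodySolver.Theorems.R2cStripCellSectorEnergyDensity
import HarnessLib

/-!
# Route `R2cOpenStripTangentLine` — optional add-on v2.3, part 2/2 (route pen sr-mbsolver-var-7 g24; filed by l1-eng-1 g28):
# TWO-CHARGE `(n↑, n↓)` SECTORS for strip-cell certificates

HONEST FRAMING: first certified bounds; not a superconductivity verdict; every number certified or labelled float.
NO NUMBER IS CLAIMED HERE (every theorem is producer-free structure or an implication from a certificate's data).

The landed per-sector row-maker `energyDensityTT'_le_of_exists_stripCellCert` (v2.2) blocks the dual matrix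
`(c_cert − η)·1 − W(A; hh, Z)` by ONE integer cut label (the total cell charge, `Upper.cellCharge`). eng-1's verifier
(`FORMAT-bdstrip-cell-v1.md`, step 4) checks positivity per `(q↑, q↓)` block: the strip tensor `K`, the dual `Z` and every
Hubbard bond word conserve `n↑` and `n↓` SEPARATELY (part 1/2, `Upper/StripCellSpinCharge.lean`:
`Upper.cellSpinCharge`, `Upper.stripCellBondMatrix_conservesSpinCharge`). A node typed with the v2.2 row-maker is implied by
the verifier's PASS only through the sentence "a total-charge block is the direct sum of its `(q↑, q↓)` blocks". This file
removes that sentence: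

* Part C — **`posSemidef_sub_dualMatrix_of_sectors₂`**: per-`(lab↑, lab↓)`-sector PSD blocks ⇒ the dense dual hypothesis;
* Part D — the two-charge ROW-MAKERS `energyDensityTT'_le_of_stripCell_umps_dual_dyadic_structural_sectors₂` and the
  CLAIM-NODE PACKAGING **`energyDensityTT'_le_of_exists_stripCellCert₂`** (same scalar side goals as v2.2; the node's tensor
  data carry two label functions and the verifier's `(q↑, q↓)` blocks verbatim).

Sources: Ruelle (1969) §3.4 [Ruelle1969]; Horn–Johnson (2013) Thm 6.1.1 [HornJohnson2013]; Essler–Frahm–Göhmann–Klümper–Korepin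
(2005) §12.3.4 [EsslerEtAl2005]; eng-1 `FORMAT-bdstrip-cell-v1.md` step 4.
-/

noncomputable section

open Matrix Finset
open scoped ComplexOrder BigOperators Kronecker

namespace Summit.Ventures.CertifiedManyBodySolver.Theorems

open Literature.MathematicalPhysics.QuantumLattice
open Literature.MathematicalPhysics.QuantumLattice.JordanWigner
open Literature.MathematicalPhysics.QuantumLattice.ThermodynamicLimit
open Literature.LinearAlgebra.Matrix.PolarOrthonormalization
open Summit.Ventures.CertifiedManyBodySolver.Upper

variable {c W Q D : ℕ}

/-! ### Part C — per-`(n↑, n↓)`-sector certificates ⇒ the dense dual hypothesis -/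

section TwoLabels

/-- **Per-two-label-sector certificates ⇒ the dense dual hypothesis.** For a tensor with TWO `U(1)` block rules
(charges `chg₁, chg₂`, labels `lab₁, lab₂`), a bond matrix conserving both charges and a `Z` diagonal for the label
pair: positive-semidefinite principal blocks of `c • 1 − W(A;X,Z)`, one per occurring label PAIR, give
`c • 1 − W(A;X,Z) ⪰ 0`. [folklore] -/
theorem posSemidef_sub_dualMatrix_of_sectors₂ {Qs : ℕ} (A : MPSTensor Qs D) (lab₁ lab₂ : Fin D → ℤ) (ν₁ ν₂ : ℤ)
    (chg₁ chg₂ : Fin Qs → ℕ)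
    (hlab₁ : ∀ (S : Fin Qs) (α β : Fin D), A S α β ≠ 0 → lab₁ β + ν₁ = lab₁ α + chg₁ S)
    (hlab₂ : ∀ (S : Fin Qs) (α β : Fin D), A S α β ≠ 0 → lab₂ β + ν₂ = lab₂ α + chg₂ S)
    (X : Matrix (Fin Qs × Fin Qs) (Fin Qs × Fin Qs) ℂ)
    (hX₁ : ∀ p p', X p p' ≠ 0 → (chg₁ p.1 : ℤ) + chg₁ p.2 = chg₁ p'.1 + chg₁ p'.2)
    (hX₂ : ∀ p p', X p p' ≠ 0 → (chg₂ p.1 : ℤ) + chg₂ p.2 = chg₂ p'.1 + chg₂ p'.2)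
    (Z : Matrix (Fin D) (Fin D) ℂ) (hZ : ∀ α β, Z α β ≠ 0 → lab₁ α = lab₁ β ∧ lab₂ α = lab₂ β) (c : ℂ)
    {m : ℤ × ℤ → ℕ} (emb : ∀ q, Fin (m q) → Fin D) (hinj : ∀ q, Function.Injective (emb q))
    (hcover : ∀ α, ∃ i, emb (lab₁ α, lab₂ α) i = α)
    (hpsd : ∀ q ∈ Finset.univ.image (fun α => (lab₁ α, lab₂ α)),
      ((c • (1 : Matrix (Fin D) (Fin D) ℂ) - dualMatrix A X Z).submatrix (emb q) (emb q)).PosSemidef) :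
    (c • (1 : Matrix (Fin D) (Fin D) ℂ) - dualMatrix A X Z).PosSemidef :=
  posSemidef_of_sectors (fun α => (lab₁ α, lab₂ α))
    (fun α β h => Prod.ext
      (sub_dualMatrix_apply_ne_zero_lab A lab₁ ν₁ chg₁ hlab₁ X hX₁ Z (fun α β hz => (hZ α β hz).1) c α β h)
      (sub_dualMatrix_apply_ne_zero_lab A lab₂ ν₂ chg₂ hlab₂ X hX₂ Z (fun α β hz => (hZ α β hz).2) c α β h))
    emb hinj hcover hpsd

end TwoLabels

/-! ### Part D — two-charge row-makers -/

section RowMakers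

/-- **Row-maker, STORED (dyadic) tensor, PER-`(n↑,n↓)`-SECTOR dual certificate, PRODUCER-FREE bond-matrix bound.**
`energyDensityTT'_le_of_stripCell_umps_dual_dyadic` with `hγ hX₁ hX₂` discharged at `γ₀ = |t|·(4((c−1)W + c(W−1)) + 4W) + |U|·cW`
and the dense dual hypothesis replaced by one PSD principal block per occurring label PAIR `(lab↑ α, lab↓ α)`; the tensor's
block rules are spin-resolved (`A S α β ≠ 0 → lab_σ β + Q_σ = lab_σ α + cellSpinCharge κ σ S`), the window is on the total
label, `Q_c = Q↑ + Q↓`. Conclusion `e(t,0,U, Q_c/(cW)) ≤ c_cert/(cW)`. [cite: Ruelle1969, §3.4] [cite: HornJohnson2013, Thm. 6.1.1] -/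
theorem energyDensityTT'_le_of_stripCell_umps_dual_dyadic_structural_sectors₂ (W c : ℕ) (hW : 1 ≤ W) (hc : 0 < c)
    (κ : TensorIndex (Fin c ×ₗ Fin W) 4 ≃ Fin Q) (A : MPSTensor Q D) (t : ℝ) {U : ℝ} (hU : 0 ≤ U)
    {ε η cc z : ℝ} (hε0 : 0 ≤ ε) (hε1 : ε < 1) (hz : 0 ≤ z)
    (hG : ∀ i, ∑ j, ‖(Upper.gram A - 1) i j‖ ≤ ε)
    (r : Fin D → ℂ) (hr : star r ⬝ᵥ r = 1) (Z : Matrix (Fin D) (Fin D) ℂ)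
    (hZ₁ : (((z : ℝ) : ℂ) • (1 : Matrix (Fin D) (Fin D) ℂ) - Z).PosSemidef)
    (hZ₂ : (((z : ℝ) : ℂ) • (1 : Matrix (Fin D) (Fin D) ℂ) + Z).PosSemidef)
    (hη : (1 + 1 / (1 - ε)) * (ε / (1 - ε)) * (1 + ε) *
      ((|t| * (4 * (((c - 1) * W + c * (W - 1) : ℕ) : ℝ) + 4 * W) + |U| * (c * W)) * (1 + (1 + ε)) + z) ≤ η)
    (labU labD : Fin D → ℤ) (QU QD qmin qmax : ℤ)
    (hBCU : ∀ (S : Fin Q) (α β : Fin D), A S α β ≠ 0 → labU β + QU = labU α + cellSpinCharge κ 0 S)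
    (hBCD : ∀ (S : Fin Q) (α β : Fin D), A S α β ≠ 0 → labD β + QD = labD α + cellSpinCharge κ 1 S)
    (hlab : ∀ α, qmin ≤ labU α + labD α ∧ labU α + labD α ≤ qmax) (hQ0 : 0 < QU + QD)
    (hQ2 : QU + QD < 2 * ((c : ℤ) * (W : ℤ)))
    (hZb : ∀ α β, Z α β ≠ 0 → labU α = labU β ∧ labD α = labD β)
    {m : ℤ × ℤ → ℕ} (emb : ∀ q, Fin (m q) → Fin D) (hinj : ∀ q, Function.Injective (emb q))
    (hcover : ∀ α, ∃ i, emb (labU α, labD α) i = α)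
    (hpsd : ∀ q ∈ Finset.univ.image (fun α => (labU α, labD α)),
      (((((cc - η : ℝ) : ℂ)) • (1 : Matrix (Fin D) (Fin D) ℂ) -
          dualMatrix A (stripCellBondMatrix κ hc t U) Z).submatrix (emb q) (emb q)).PosSemidef) :
    energyDensityTT' t 0 U (((QU + QD : ℤ) : ℝ) / ((c : ℝ) * (W : ℝ))) ≤ cc / ((c : ℝ) * (W : ℝ)) := by
  have hγ : stripCellRowBound c W t U =
      |t| * (4 * (((c - 1) * W + c * (W - 1) : ℕ) : ℝ) + 4 * W) + |U| * (c * W) := stripCellRowBound_eq c W t U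
  have hγ0 : (0 : ℝ) ≤ |t| * (4 * (((c - 1) * W + c * (W - 1) : ℕ) : ℝ) + 4 * W) + |U| * (c * W) := by positivity
  obtain ⟨hX₁, hX₂⟩ := stripCellBondMatrix_loewner κ hc t U hγ.le
  have hBC : ∀ (S : Fin Q) (α β : Fin D), A S α β ≠ 0 →
      (labU β + labD β) + (QU + QD) = (labU α + labD α) + cellCharge κ S := by
    intro S α β h
    have h1 := hBCU S α β h
    have h2 := hBCD S α β h
    rw [cellCharge_eq_cellSpinCharge_add]
    push_cast
    linarith
  have hWd := posSemidef_sub_dualMatrix_of_sectors₂ A labU labD QU QD (cellSpinCharge κ 0) (cellSpinCharge κ 1)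
    hBCU hBCD (stripCellBondMatrix κ hc t U) (stripCellBondMatrix_conservesSpinCharge κ hc t U 0)
    (stripCellBondMatrix_conservesSpinCharge κ hc t U 1) Z hZb _ emb hinj hcover hpsd
  exact energyDensityTT'_le_of_stripCell_umps_dual_dyadic W c hW hc κ A t hU hε0 hε1 hγ0 hz hG hX₁ hX₂ r hr Z hZ₁ hZ₂
    hη hWd (fun α => labU α + labD α) (QU + QD) qmin qmax hBC hlab hQ0 hQ2

/-- **CLAIM-NODE PACKAGING, two-charge sectors (energy-density row).** The shape a `Certificates/…` claim node for a
`bd-strip-cell-v1` certificate takes with the verifier's `(q↑, q↓)` blocks VERBATIM: tensor data `A, r, Z, lab↑, lab↓, m, emb`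
in ONE existential proposition, the scalar side conditions outside as `norm_num` goals. Conclusion
`e(t,0,U, (Q↑+Q↓)/(cW)) ≤ c_cert/(cW)`. HONEST FRAMING: nothing here asserts that such a certificate exists. -/
theorem energyDensityTT'_le_of_exists_stripCellCert₂ (W c : ℕ) (hW : 1 ≤ W) (hc : 0 < c)
    (κ : TensorIndex (Fin c ×ₗ Fin W) 4 ≃ Fin Q) (D : ℕ) (t : ℝ) {U : ℝ} (hU : 0 ≤ U) (ε η cc z : ℝ)
    (QU QD qmin qmax : ℤ) (hε0 : 0 ≤ ε) (hε1 : ε < 1) (hz : 0 ≤ z)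
    (hη : (1 + 1 / (1 - ε)) * (ε / (1 - ε)) * (1 + ε) *
      ((|t| * (4 * (((c - 1) * W + c * (W - 1) : ℕ) : ℝ) + 4 * W) + |U| * (c * W)) * (1 + (1 + ε)) + z) ≤ η)
    (hQ0 : 0 < QU + QD) (hQ2 : QU + QD < 2 * ((c : ℤ) * (W : ℤ)))
    (hex : ∃ (A : MPSTensor Q D) (r : Fin D → ℂ) (Z : Matrix (Fin D) (Fin D) ℂ) (labU labD : Fin D → ℤ)
        (m : ℤ × ℤ → ℕ) (emb : ∀ q, Fin (m q) → Fin D),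
        (∀ i, ∑ j, ‖(Upper.gram A - 1) i j‖ ≤ ε) ∧ star r ⬝ᵥ r = 1 ∧
        ((((z : ℝ) : ℂ)) • (1 : Matrix (Fin D) (Fin D) ℂ) - Z).PosSemidef ∧
        ((((z : ℝ) : ℂ)) • (1 : Matrix (Fin D) (Fin D) ℂ) + Z).PosSemidef ∧
        (∀ (S : Fin Q) (α β : Fin D), A S α β ≠ 0 → labU β + QU = labU α + cellSpinCharge κ 0 S) ∧
        (∀ (S : Fin Q) (α β : Fin D), A S α β ≠ 0 → labD β + QD = labD α + cellSpinCharge κ 1 S) ∧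
        (∀ α, qmin ≤ labU α + labD α ∧ labU α + labD α ≤ qmax) ∧
        (∀ α β, Z α β ≠ 0 → labU α = labU β ∧ labD α = labD β) ∧
        (∀ q, Function.Injective (emb q)) ∧ (∀ α, ∃ i, emb (labU α, labD α) i = α) ∧
        (∀ q ∈ Finset.univ.image (fun α => (labU α, labD α)),
          (((((cc - η : ℝ) : ℂ)) • (1 : Matrix (Fin D) (Fin D) ℂ) -
              dualMatrix A (stripCellBondMatrix κ hc t U) Z).submatrix (emb q) (emb q)).PosSemidef)) :
    energyDensityTT' t 0 U (((QU + QD : ℤ) : ℝ) / ((c : ℝ) * (W : ℝ))) ≤ cc / ((c : ℝ) * (W : ℝ)) := by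
  obtain ⟨A, r, Z, labU, labD, m, emb, hG, hr, hZ₁, hZ₂, hBCU, hBCD, hlab, hZb, hinj, hcover, hpsd⟩ := hex
  exact energyDensityTT'_le_of_stripCell_umps_dual_dyadic_structural_sectors₂ W c hW hc κ A t hU hε0 hε1 hz hG r hr Z
    hZ₁ hZ₂ hη labU labD QU QD qmin qmax hBCU hBCD hlab hQ0 hQ2 hZb emb hinj hcover hpsd

end RowMakers

end Summit.Ventures.CertifiedManyBodySolver.Theorems

end
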